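import Summits.QuantumFields.YangMills.Theorems.BalabanLadderNTReferenceTransferCumulant
import HarnessLib

/-!
# Crux `NT` (stmt-QuantumFields-19353): reference-state transfer, XVI — NESTING of the two/three-point exterior
# oscillations (the tools to reduce E2-osc / E3-osc to the engine's own cube tower)

Helper file (`--supports stmt-QuantumFields-19353`) of the fleet lead prover of crux `NT` (unit `ym-spine-19353-p1`,
g4).  Skeleton of record v4T «periodic-reference» (`stub_refpkgT : RefPkgT`, owner RULING R60): the engine owes the
exterior-oscillation ceilings E1/E2/E3-osc on femto cubes.  For E1-osc the oscillation is ANTITONE under nesting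
(`BoundaryLaw.abs_kerE_sub_kerE_le_of_subset`, g3), which is what reduced it to centred cubes / geometric radii.  The
two- and three-point oscillations are antitone UP TO ONE-POINT TERMS — the laws of total covariance / cumulance of file I
read between two exteriors of the BIG cube:

* `abs_kerCov_sub_kerCov_le_of_subset` — `P ⊆ Q`, bounded continuous `F, G'`: for all exteriors `η, η'` of `Q`,
  `|kerCov_Q^η(F,G') − kerCov_Q^{η'}(F,G')| ≤ 2 h h' + ω` (`h, h'` = one-point, `ω` = covariance oscillation of the
  `P`-kernel data over the exteriors of `P`);
* `abs_kerK3_sub_kerK3_le_of_subset` — three sites: `|kerK3_Q^η − kerK3_Q^{η'}| ≤ 2 (k_x w_yz + k_y w_xz + k_z w_xy +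
  k_x k_y k_z) + ω₃`;
* `abs_kerCov_dens_sub_le_of_subset` — the two-density instance.

So a bound of E2/E3-osc type proved on a family of cubes that NESTS AROUND every deep pair/triple (e.g. the engine's
`L^k`-tower, cf. `fbl_of_oscillation_seq`) propagates to all cubes, the one-point corrections being E1-osc products.
-/

set_option autoImplicit false

noncomputable section

open MeasureTheory Filter Topology
open Literature.MathematicalPhysics.QuantumFieldTheory Literature.MathematicalPhysics.QuantumLattice
open Literature.Probability.LatticeModels
open Summit.QuantumFields.YangMills.Cruxes.OSLegsFromFemtoAndGap.DlrCollarTransfer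
open Summit.QuantumFields.YangMills.Cruxes.OSLegsFromFemtoAndGap.DlrCollarTransfer.StubLower (exists_abs_dens_le)

namespace Summit.QuantumFields.YangMills.Cruxes.NT.Reference

variable (G : Type) [Group G] [TopologicalSpace G] [IsTopologicalGroup G] [CompactSpace G]
  [MeasurableSpace G] [BorelSpace G] (r : LatticeRep G)

/-- **Nesting of the two-point exterior oscillation.**  `P = (c₀,b₀) ⊆ Q = (c,b)`, bounded continuous `F, G'` whose
`P`-kernel means oscillate over the exteriors of `P` by `≤ h, h'` and whose `P`-kernel covariance oscillates by `≤ ω`: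
then the `Q`-kernel covariance oscillates over the exteriors of `Q` by at most `2 h h' + ω`. [folklore] -/
theorem abs_kerCov_sub_kerCov_le_of_subset (β : ℝ) {c c₀ : Fin 4 → ℤ} {b b₀ : ℕ}
    (hsub : cubeEdges c₀ b₀ ⊆ cubeEdges c b) {F G' : LGConfig 4 G → ℝ}
    (hFc : Continuous F) (hGc : Continuous G') {MF MG : ℝ} (hMF : ∀ U, |F U| ≤ MF) (hMG : ∀ U, |G' U| ≤ MG)
    {h h' ω : ℝ} (hoF : ∀ ζ ζ', |kerE G r β c₀ b₀ ζ F - kerE G r β c₀ b₀ ζ' F| ≤ h)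
    (hoG : ∀ ζ ζ', |kerE G r β c₀ b₀ ζ G' - kerE G r β c₀ b₀ ζ' G'| ≤ h')
    (hoC : ∀ ζ ζ', |kerCov G r β c₀ b₀ ζ F G' - kerCov G r β c₀ b₀ ζ' F G'| ≤ ω) (η η' : LGConfig 4 G) :
    |kerCov G r β c b η F G' - kerCov G r β c b η' F G'| ≤ 2 * h * h' + ω := by
  haveI := r.secondCountableTopology
  haveI := isProbabilityMeasure_ymSpecification r.ρ r.continuous β (cubeEdges c b) η
  haveI := isProbabilityMeasure_ymSpecification r.ρ r.continuous β (cubeEdges c b) η'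
  have t1 := abs_kerCov_sub_kerE_kerCov_le G r β hsub η hFc hGc hMF hMG hoF hoG
  have t2 := abs_kerCov_sub_kerE_kerCov_le G r β hsub η' hFc hGc hMF hMG hoF hoG
  have hcont := continuous_kerCov G r β c₀ b₀ hFc hGc hMF hMG
  have t3 : |kerE G r β c b η (fun ζ => kerCov G r β c₀ b₀ ζ F G') -
      kerE G r β c b η' (fun ζ => kerCov G r β c₀ b₀ ζ F G')| ≤ ω := by
    unfold kerE
    exact abs_integral_sub_integral_le_of_osc hcont hcont (fun ζ ζ' => hoC _ _)
  have tri := abs_sub_le (kerCov G r β c b η F G') (kerE G r β c b η (fun ζ => kerCov G r β c₀ b₀ ζ F G'))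
    (kerCov G r β c b η' F G')
  have tri₂ := abs_sub_le (kerE G r β c b η (fun ζ => kerCov G r β c₀ b₀ ζ F G'))
    (kerE G r β c b η' (fun ζ => kerCov G r β c₀ b₀ ζ F G')) (kerCov G r β c b η' F G')
  rw [abs_sub_comm] at t2
  linarith

/-- **Nesting of the two-point exterior oscillation, two action densities.** [folklore] -/
theorem abs_kerCov_dens_sub_le_of_subset (β : ℝ) {c c₀ : Fin 4 → ℤ} {b b₀ : ℕ}
    (hsub : cubeEdges c₀ b₀ ⊆ cubeEdges c b) {x y : Fin 4 → ℤ} {hx' hy' ω : ℝ}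
    (hox : ∀ ζ ζ', |kerE G r β c₀ b₀ ζ (dens G r x) - kerE G r β c₀ b₀ ζ' (dens G r x)| ≤ hx')
    (hoy : ∀ ζ ζ', |kerE G r β c₀ b₀ ζ (dens G r y) - kerE G r β c₀ b₀ ζ' (dens G r y)| ≤ hy')
    (hoC : ∀ ζ ζ', |kerCov G r β c₀ b₀ ζ (dens G r x) (dens G r y) -
      kerCov G r β c₀ b₀ ζ' (dens G r x) (dens G r y)| ≤ ω) (η η' : LGConfig 4 G) :
    |kerCov G r β c b η (dens G r x) (dens G r y) - kerCov G r β c b η' (dens G r x) (dens G r y)| ≤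
      2 * hx' * hy' + ω := by
  obtain ⟨M, -, hM⟩ := exists_abs_dens_le G r
  exact abs_kerCov_sub_kerCov_le_of_subset G r β hsub (continuous_dens r x) (continuous_dens r y) (hM x) (hM y)
    hox hoy hoC η η'

/-- **Nesting of the three-point exterior oscillation.**  `P ⊆ Q`, sites `x, y, z`; one-point (`k`), covariance (`w`)
and third-cumulant (`ω₃`) oscillations of the `P`-kernel data over the exteriors of `P`: then for all exteriors `η, η'`
of `Q`, `|kerK3_Q^η(x,y,z) − kerK3_Q^{η'}(x,y,z)| ≤ 2 (k_x w_{yz} + k_y w_{xz} + k_z w_{xy} + k_x k_y k_z) + ω₃`. [folklore] -/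
theorem abs_kerK3_sub_kerK3_le_of_subset (β : ℝ) {c c₀ : Fin 4 → ℤ} {b b₀ : ℕ}
    (hsub : cubeEdges c₀ b₀ ⊆ cubeEdges c b) (x y z : Fin 4 → ℤ) {kx ky kz wyz wxz wxy ω₃ : ℝ}
    (hox : ∀ ζ ζ', |kerE G r β c₀ b₀ ζ (dens G r x) - kerE G r β c₀ b₀ ζ' (dens G r x)| ≤ kx)
    (hoy : ∀ ζ ζ', |kerE G r β c₀ b₀ ζ (dens G r y) - kerE G r β c₀ b₀ ζ' (dens G r y)| ≤ ky)
    (hoz : ∀ ζ ζ', |kerE G r β c₀ b₀ ζ (dens G r z) - kerE G r β c₀ b₀ ζ' (dens G r z)| ≤ kz)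
    (hoyz : ∀ ζ ζ', |kerCov G r β c₀ b₀ ζ (dens G r y) (dens G r z) -
      kerCov G r β c₀ b₀ ζ' (dens G r y) (dens G r z)| ≤ wyz)
    (hoxz : ∀ ζ ζ', |kerCov G r β c₀ b₀ ζ (dens G r x) (dens G r z) -
      kerCov G r β c₀ b₀ ζ' (dens G r x) (dens G r z)| ≤ wxz)
    (hoxy : ∀ ζ ζ', |kerCov G r β c₀ b₀ ζ (dens G r x) (dens G r y) -
      kerCov G r β c₀ b₀ ζ' (dens G r x) (dens G r y)| ≤ wxy)
    (ho3 : ∀ ζ ζ', |kerK3 G r β c₀ b₀ ζ x y z - kerK3 G r β c₀ b₀ ζ' x y z| ≤ ω₃) (η η' : LGConfig 4 G) :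
    |kerK3 G r β c b η x y z - kerK3 G r β c b η' x y z| ≤
      2 * (kx * wyz + ky * wxz + kz * wxy + kx * ky * kz) + ω₃ := by
  haveI := r.secondCountableTopology
  haveI := isProbabilityMeasure_ymSpecification r.ρ r.continuous β (cubeEdges c b) η
  haveI := isProbabilityMeasure_ymSpecification r.ρ r.continuous β (cubeEdges c b) η'
  obtain ⟨M, -, hM⟩ := exists_abs_dens_le G r
  have t1 := abs_kerK3_sub_kerE_kerK3_le G r β hsub η x y z hox hoy hoz hoyz hoxz hoxy
  have t2 := abs_kerK3_sub_kerE_kerK3_le G r β hsub η' x y z hox hoy hoz hoyz hoxz hoxy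
  have cx := continuous_dens r x
  have cy := continuous_dens r y
  have cz := continuous_dens r z
  have cxy : Continuous fun U => dens G r x U * dens G r y U := cx.mul cy
  have cxz : Continuous fun U => dens G r x U * dens G r z U := cx.mul cz
  have cyz : Continuous fun U => dens G r y U * dens G r z U := cy.mul cz
  have cxyz : Continuous fun U => dens G r x U * dens G r y U * dens G r z U := cxy.mul cz
  have bxy : ∀ U, |dens G r x U * dens G r y U| ≤ M * M := abs_mul_le_of_abs_le G (hM x) (hM y)
  have bxz : ∀ U, |dens G r x U * dens G r z U| ≤ M * M := abs_mul_le_of_abs_le G (hM x) (hM z)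
  have byz : ∀ U, |dens G r y U * dens G r z U| ≤ M * M := abs_mul_le_of_abs_le G (hM y) (hM z)
  have bxyz : ∀ U, |dens G r x U * dens G r y U * dens G r z U| ≤ M * M * M :=
    abs_mul_le_of_abs_le G bxy (hM z)
  have hcont : Continuous fun ζ => kerK3 G r β c₀ b₀ ζ x y z := by
    unfold kerK3
    have k1 := continuous_kerE G r β c₀ b₀ cx (hM x)
    have k2 := continuous_kerE G r β c₀ b₀ cy (hM y)
    have k3 := continuous_kerE G r β c₀ b₀ cz (hM z)
    have k12 := continuous_kerE G r β c₀ b₀ cxy bxy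
    have k13 := continuous_kerE G r β c₀ b₀ cxz bxz
    have k23 := continuous_kerE G r β c₀ b₀ cyz byz
    have k123 := continuous_kerE G r β c₀ b₀ cxyz bxyz
    exact (((k123.sub (k1.mul k23)).sub (k2.mul k13)).sub (k3.mul k12)).add
      (continuous_const.mul ((k1.mul k2).mul k3))
  have t3 : |kerE G r β c b η (fun ζ => kerK3 G r β c₀ b₀ ζ x y z) -
      kerE G r β c b η' (fun ζ => kerK3 G r β c₀ b₀ ζ x y z)| ≤ ω₃ := by
    unfold kerE
    exact abs_integral_sub_integral_le_of_osc hcont hcont (fun ζ ζ' => ho3 _ _)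
  have tri := abs_sub_le (kerK3 G r β c b η x y z) (kerE G r β c b η (fun ζ => kerK3 G r β c₀ b₀ ζ x y z))
    (kerK3 G r β c b η' x y z)
  have tri₂ := abs_sub_le (kerE G r β c b η (fun ζ => kerK3 G r β c₀ b₀ ζ x y z))
    (kerE G r β c b η' (fun ζ => kerK3 G r β c₀ b₀ ζ x y z)) (kerK3 G r β c b η' x y z)
  rw [abs_sub_comm] at t2
  linarith

end Summit.QuantumFields.YangMills.Cruxes.NT.Reference

end
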